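import Literature.Probability.LatticeModels.ThermodynamicLimit
import Mathlib.Analysis.SpecificLimits.Basic
import Mathlib.Topology.Algebra.InfiniteSum.ENNReal
import HarnessLib

/-!
# `PercLongRangeCatalyst.SubcritCatalystStability` (stmt-CriticalPhenomena-4824) — II: summing the long-edge chains

RSW3 lane (lead, gen 31).  Helper lemmas for item `stmt-CriticalPhenomena-4824` (below `p_c(ℤ³)` a sparse long-range catalyst
does not percolate).  PURE ANALYSIS on `ℤ³` for two translation-invariant kernels `T, Q : ℤ³ → [0, ∞]` (in the application
`T(v) = τ_{p′}(0, v)` is the nearest-neighbour two-point function and `Q(v)` bounds the probability of the long edge `{x, x+v}`):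
the Aizenman–Newman weight of a long-edge chain `(a_i, b_i)_{i<k}` from `s` to `z`,
`T(a_0 − s) · Π_i Q(b_i − a_i) T(a_{i+1} − b_i)` (`a_k := z`), summed over all chains of length `k` and all endpoints `z`, is
EXACTLY `χ_T (χ_Q χ_T)^k` (`levelSum_eq`; `χ_T = Σ_v T(v)`, `χ_Q = Σ_v Q(v)`), by splitting off the first long edge under
`Fin.cons` (`weight_cons`).  Hence `Σ_k Σ_chains = χ_T Σ_k (χ_Q χ_T)^k`, finite as soon as `χ_Q χ_T < 1` — the
cluster-of-clusters bound `χ ≤ Σ_k χ_nn^{k+1} (λ b K_α)^k` of the route text.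

No definitions, no sorries; the chain weight is written out in each statement (`Fin`-indexed pairs `(a_i, b_i)`).
Reference: M. Aizenman, C. M. Newman, J. Stat. Phys. 36 (1984) §4 (cluster-of-clusters bound) [AizenmanNewman1984].
-/

noncomputable section

namespace Summit.CriticalPhenomena.PercolationContinuityZ3.Theorems

namespace SubcritCatalystStability

open Finset Literature.Probability.LatticeModels
open scoped ENNReal

/-! ### The chain weight and its first-edge decomposition -/

/-- First-edge decomposition of the long-edge chain WEIGHT under `Fin.cons`:
`W_{k+1}(s; (a,b) :: g; z) = T(a − s) · Q(b − a) · W_k(b; g; z)`. [folklore] -/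
theorem weight_cons (T Q : Site 3 → ℝ≥0∞) {k : ℕ} (s z : Site 3) (e₀ : Site 3 × Site 3) (g : Fin k → Site 3 × Site 3) :
    T ((if h : 0 < k + 1 then ((Fin.cons e₀ g : Fin (k + 1) → Site 3 × Site 3) ⟨0, h⟩).1 else z) - s) *
        ∏ i : Fin (k + 1), (Q (((Fin.cons e₀ g : Fin (k + 1) → Site 3 × Site 3) i).2 -
            ((Fin.cons e₀ g : Fin (k + 1) → Site 3 × Site 3) i).1) *
          T ((if h : i.1 + 1 < k + 1 then ((Fin.cons e₀ g : Fin (k + 1) → Site 3 × Site 3) ⟨i.1 + 1, h⟩).1 else z) -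
            ((Fin.cons e₀ g : Fin (k + 1) → Site 3 × Site 3) i).2)) =
      T (e₀.1 - s) * Q (e₀.2 - e₀.1) *
        (T ((if h : 0 < k then (g ⟨0, h⟩).1 else z) - e₀.2) *
          ∏ i : Fin k, (Q ((g i).2 - (g i).1) * T ((if h : i.1 + 1 < k then (g ⟨i.1 + 1, h⟩).1 else z) - (g i).2))) := by
  have e0 : ∀ h : 0 < k + 1, ((Fin.cons e₀ g : Fin (k + 1) → Site 3 × Site 3) ⟨0, h⟩) = e₀ := fun h => rfl
  have es : ∀ (i : ℕ) (h : i + 1 < k + 1),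
      ((Fin.cons e₀ g : Fin (k + 1) → Site 3 × Site 3) ⟨i + 1, h⟩) = g ⟨i, by omega⟩ := fun i h => rfl
  rw [dif_pos (Nat.succ_pos k), e0, Fin.prod_univ_succ]
  have h0 : ((Fin.cons e₀ g : Fin (k + 1) → Site 3 × Site 3) 0) = e₀ := rfl
  rw [h0]
  have hfirst : T ((if h : (0 : Fin (k + 1)).1 + 1 < k + 1 then
        ((Fin.cons e₀ g : Fin (k + 1) → Site 3 × Site 3) ⟨(0 : Fin (k + 1)).1 + 1, h⟩).1 else z) - e₀.2) =
      T ((if h : 0 < k then (g ⟨0, h⟩).1 else z) - e₀.2) := by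
    congr 2
    by_cases hk : 0 < k
    · rw [dif_pos (by simp; omega), dif_pos hk]
      exact congrArg Prod.fst (es 0 (by omega))
    · rw [dif_neg (by simp; omega), dif_neg hk]
  rw [hfirst]
  have hrest : ∏ i : Fin k, (Q (((Fin.cons e₀ g : Fin (k + 1) → Site 3 × Site 3) i.succ).2 -
        ((Fin.cons e₀ g : Fin (k + 1) → Site 3 × Site 3) i.succ).1) *
      T ((if h : (i.succ : Fin (k + 1)).1 + 1 < k + 1 then
          ((Fin.cons e₀ g : Fin (k + 1) → Site 3 × Site 3) ⟨(i.succ : Fin (k + 1)).1 + 1, h⟩).1 else z) -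
        ((Fin.cons e₀ g : Fin (k + 1) → Site 3 × Site 3) i.succ).2)) =
      ∏ i : Fin k, (Q ((g i).2 - (g i).1) * T ((if h : i.1 + 1 < k then (g ⟨i.1 + 1, h⟩).1 else z) - (g i).2)) := by
    refine Finset.prod_congr rfl fun i _ => ?_
    have hv : (i.succ : Fin (k + 1)).1 = i.1 + 1 := rfl
    rw [Fin.cons_succ]
    congr 3
    by_cases hik : i.1 + 1 < k
    · rw [dif_pos (by rw [hv]; omega), dif_pos hik]
      have : (⟨(i.succ : Fin (k + 1)).1 + 1, by rw [hv]; omega⟩ : Fin (k + 1)) = ⟨i.1 + 1 + 1, by omega⟩ :=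
        Fin.ext (by simp)
      rw [this]
      exact congrArg Prod.fst (es (i.1 + 1) (by omega))
    · rw [dif_neg (by rw [hv]; omega), dif_neg hik]
  rw [hrest]
  ring

/-! ### Level sums -/

/-- **The level-zero sum is the susceptibility**: `Σ_z T(z − s) = Σ_v T(v)`. [folklore] -/
theorem levelSum_zero (T Q : Site 3 → ℝ≥0∞) (s : Site 3) :
    (∑' g : Fin 0 → Site 3 × Site 3, ∑' z : Site 3,
      T ((if h : 0 < 0 then (g ⟨0, h⟩).1 else z) - s) *
        ∏ i : Fin 0, (Q ((g i).2 - (g i).1) * T ((if h : i.1 + 1 < 0 then (g ⟨i.1 + 1, h⟩).1 else z) - (g i).2))) =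
    ∑' v : Site 3, T v := by
  rw [tsum_fintype, Fintype.sum_unique, ← (Equiv.subRight s).tsum_eq T]
  refine tsum_congr fun z => ?_
  rw [dif_neg (lt_irrefl 0), Finset.univ_eq_empty, Finset.prod_empty, mul_one]
  rfl

/-- **First-edge recurrence for the level sums**:
`L_{k+1}(s) = Σ_{(a,b)} T(a − s) Q(b − a) L_k(b)`. [cite: AizenmanNewman1984, §4] -/
theorem levelSum_succ (T Q : Site 3 → ℝ≥0∞) (k : ℕ) (s : Site 3) :
    (∑' g : Fin (k + 1) → Site 3 × Site 3, ∑' z : Site 3,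
      T ((if h : 0 < k + 1 then (g ⟨0, h⟩).1 else z) - s) *
        ∏ i : Fin (k + 1), (Q ((g i).2 - (g i).1) *
          T ((if h : i.1 + 1 < k + 1 then (g ⟨i.1 + 1, h⟩).1 else z) - (g i).2))) =
    ∑' e₀ : Site 3 × Site 3, T (e₀.1 - s) * Q (e₀.2 - e₀.1) *
      ∑' g : Fin k → Site 3 × Site 3, ∑' z : Site 3,
        T ((if h : 0 < k then (g ⟨0, h⟩).1 else z) - e₀.2) *
          ∏ i : Fin k, (Q ((g i).2 - (g i).1) * T ((if h : i.1 + 1 < k then (g ⟨i.1 + 1, h⟩).1 else z) - (g i).2)) := by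
  rw [← (Fin.consEquiv fun _ : Fin (k + 1) => Site 3 × Site 3).tsum_eq, ENNReal.tsum_prod']
  refine tsum_congr fun e₀ => ?_
  rw [← ENNReal.tsum_mul_left]
  refine tsum_congr fun g => ?_
  rw [← ENNReal.tsum_mul_left]
  refine tsum_congr fun z => ?_
  exact weight_cons T Q s z e₀ g

/-- **The level sums in closed form**: the chains of `k` long edges from `s`, summed over the chain and the endpoint, weigh
exactly `χ_T (χ_Q χ_T)^k`. [cite: AizenmanNewman1984, §4] -/
theorem levelSum_eq (T Q : Site 3 → ℝ≥0∞) :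
    ∀ (k : ℕ) (s : Site 3),
      (∑' g : Fin k → Site 3 × Site 3, ∑' z : Site 3,
        T ((if h : 0 < k then (g ⟨0, h⟩).1 else z) - s) *
          ∏ i : Fin k, (Q ((g i).2 - (g i).1) * T ((if h : i.1 + 1 < k then (g ⟨i.1 + 1, h⟩).1 else z) - (g i).2))) =
      (∑' v : Site 3, T v) * ((∑' v : Site 3, Q v) * ∑' v : Site 3, T v) ^ k := by
  intro k
  induction k with
  | zero =>
      intro s
      rw [levelSum_zero, pow_zero, mul_one]
  | succ k ih =>
      intro s
      rw [levelSum_succ]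
      simp only [ih]
      rw [ENNReal.tsum_mul_right, ENNReal.tsum_prod']
      have hinner : ∀ a : Site 3, ∑' b : Site 3, T ((a, b).1 - s) * Q ((a, b).2 - (a, b).1) =
          T (a - s) * ∑' v : Site 3, Q v := by
        intro a
        simp only
        rw [ENNReal.tsum_mul_left]
        congr 1
        exact (Equiv.subRight a).tsum_eq Q
      rw [tsum_congr hinner, ENNReal.tsum_mul_right]
      have hT : ∑' a : Site 3, T (a - s) = ∑' v : Site 3, T v := (Equiv.subRight s).tsum_eq T
      rw [hT]
      ring

/-- **Summing over the number of long edges**: `Σ_k L_k(s) = χ_T Σ_k (χ_Q χ_T)^k = χ_T (1 − χ_Q χ_T)⁻¹`.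
[cite: AizenmanNewman1984, §4] -/
theorem tsum_levelSum_eq (T Q : Site 3 → ℝ≥0∞) (s : Site 3) :
    (∑' k : ℕ, ∑' g : Fin k → Site 3 × Site 3, ∑' z : Site 3,
      T ((if h : 0 < k then (g ⟨0, h⟩).1 else z) - s) *
        ∏ i : Fin k, (Q ((g i).2 - (g i).1) * T ((if h : i.1 + 1 < k then (g ⟨i.1 + 1, h⟩).1 else z) - (g i).2))) =
      (∑' v : Site 3, T v) * (1 - (∑' v : Site 3, Q v) * ∑' v : Site 3, T v)⁻¹ := by
  rw [← ENNReal.tsum_geometric, ← ENNReal.tsum_mul_left]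
  exact tsum_congr fun k => levelSum_eq T Q k s

/-- The level-zero sum is at most the susceptibility (re-commit corollary of `levelSum_zero`). [folklore] -/
theorem levelSum_zero_le (T Q : Site 3 → ℝ≥0∞) (s : Site 3) :
    (∑' g : Fin 0 → Site 3 × Site 3, ∑' z : Site 3,
      T ((if h : 0 < 0 then (g ⟨0, h⟩).1 else z) - s) *
        ∏ i : Fin 0, (Q ((g i).2 - (g i).1) * T ((if h : i.1 + 1 < 0 then (g ⟨i.1 + 1, h⟩).1 else z) - (g i).2))) ≤
    ∑' v : Site 3, T v :=
  (levelSum_zero T Q s).le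

end SubcritCatalystStability

end Summit.CriticalPhenomena.PercolationContinuityZ3.Theorems

end
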